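import Mathlib
import HarnessLib
import Literature.LinearAlgebra.Matrix.ChordalPositiveSemidefinite

/-!
# Chordal graphs, Dirac's simplicial vertex theorem and perfect elimination orderings
(Vandenberghe–Andersen 2015, §3.1, §3.3–3.4, §4.1–4.2)

Topic `Literature/Combinatorics/SimpleGraph`.  The graph-theoretic vocabulary behind the tree's
chordal-sparsity files (`Literature.LinearAlgebra.Matrix.ChordalPositiveSemidefinite`, `…Completion`,
`…ChordalCholesky`, `…ChordalEliminationTree`, `…ChordalMaximumDeterminantCompletion`), which all work
with a FIXED ordering of the index type and the "filled / monotone transitive" condition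
`MonotoneTransitive E` ([VA15, (4.1)]).  This file supplies the order-free notions and the bridge:

* `IsChordlessCycle G c` — a cycle `c : Fin k → V` (`k ≥ 4`, distinct vertices, cyclically consecutive
  vertices adjacent, successor = `finRotate k`) WITHOUT CHORD [VA15, §3.1]; `IsChordal G` — "every
  cycle of length greater than three has a chord" [VA15, §3.1]; `IsChordal.induce` — induced
  subgraphs of chordal graphs are chordal [VA15, §3.1, p. 257];
* `IsSimplicial G v` — the neighbourhood of `v` is complete [VA15, §3.4];
* `IsPerfectEliminationLabelling G f` — an injective labelling `f : V → ℕ` whose ordered graph is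
  filled (a perfect elimination ordering, [VA15, §4.2]);
* `isChordal_of_monotoneTransitive` — [VA15, §4.1]: a filled ordered graph is chordal (the least
  vertex of a long cycle has its two cycle-neighbours in `adj⁺`, hence a chord), and the labelling
  form `IsPerfectEliminationLabelling.isChordal` (the "if" half of [VA15, Thm 4.1]);
* `DiracSimplicialVertexTheorem` — the named statement "every (finite, non-empty) chordal graph has
  at least one simplicial vertex" [VA15, Thm 3.3; Dirac 1961, Rose 1970], PROVED here:
  `diracSimplicialVertexTheorem_holds`, via `IsChordal.complete_or_exists_two_isSimplicial` (both
  sentences of Thm 3.3: complete, or two non-adjacent simplicial vertices) and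
  `IsChordal.exists_isSimplicial`.  The proof (section `DiracProof`, all auxiliaries private) is the
  one of [VA15, §3.3–3.4] relativised to finite vertex sets of the ambient type: paths of `G(U)` as
  the reflexive–transitive closure of the adjacency restricted to `U`; [VA15, Thm 3.1] — a
  `vw`-separator none of whose one-point deletions separates is complete, since two non-adjacent
  vertices of it would close two minimal detours through the components of `v` and `w` into a
  chordless cycle of length `≥ 4` (`adj_of_mem_minSeparator`,
  `exists_isChordlessCycle_of_isMinDetour`); and Dirac's induction on `G(C_v ∪ S)`, `G(C_w ∪ S)`
  (`completeOn_or_exists_simplicialIn`);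
* `IsChordal.exists_isPerfectEliminationLabelling` — [VA15, Thm 4.1] "only if" (Fulkerson–Gross
  1965) by simplicial elimination (strong induction on finite vertex sets, a simplicial vertex of
  `G(S)` labelled first), stated relative to the named fact and then unconditionally
  (`IsChordal.exists_isPerfectEliminationLabelling'`); packaged as
  `isChordal_iff_exists_isPerfectEliminationLabelling(')` and, with the ordering as a `LinearOrder`
  structure, `isChordal_iff_exists_linearOrder_monotoneTransitive(')` — a finite graph is chordal iff
  SOME linear order of `V` makes `G.Adj` monotone transitive, which is the standing hypothesis
  `MonotoneTransitive E` of every matrix file in the series.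

NOT here: vertex separators and connected components as public notions (they appear only inside the
private proof, relativised to vertex sets); clique trees, the running-intersection property and the
algorithmic orderings (maximum cardinality search, Lex-BFS) of [VA15, §3.5–3.7, §4.3–4.7].

References: L. Vandenberghe, M. S. Andersen, *Chordal Graphs and Semidefinite Optimization*,
Found. Trends Optim. 1(4) (2015) 241–433, §3.1 (pp. 256–257), §3.3 (pp. 261–262, Thm 3.1), §3.4 (pp. 263–265,
Thm 3.3), §4.1–4.2 (pp. 276–277, Thm 4.1) [bib: VandenbergheAndersen2015]; the originals cited there: G. A. Dirac, *On
rigid circuit graphs*, Abh. Math. Sem. Univ. Hamburg 25 (1961) [VA15 ref. 74]; D. R. Fulkerson,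
O. A. Gross, *Incidence matrices and interval graphs*, Pacific J. Math. 15 (1965) [VA15 ref. 88];
D. J. Rose, *Triangulated graphs and the elimination process*, J. Math. Anal. Appl. 32 (1970)
[VA15 ref. 193].
-/

namespace Literature.Combinatorics.SimpleGraph

open Literature.LinearAlgebra.Matrix.ChordalSparsity (MonotoneTransitive)

universe u

variable {V : Type u}

/-- A CHORDLESS CYCLE of length `k > 3`: distinct vertices `c 0, …, c (k-1)` with consecutive
ones adjacent (cyclically: `c i ~ c (i+1 mod k)`, the successor being `finRotate k`) and NO CHORD —
"a chord in a cycle `(v₀, …, v_{k-1}, v₀)` is an edge `{vᵢ, vⱼ}` with `(j − i) mod k > 1`", so the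
only adjacencies among the `c i` are the consecutive ones.
[cite: VandenbergheAndersen2015, §3.1 (p. 256)] -/
structure IsChordlessCycle (G : _root_.SimpleGraph V) {k : ℕ} (c : Fin k → V) : Prop where
  four_le : 4 ≤ k
  injective : Function.Injective c
  adj_next : ∀ i, G.Adj (c i) (c (finRotate k i))
  no_chord : ∀ ⦃i j⦄, G.Adj (c i) (c j) → j = finRotate k i ∨ i = finRotate k j

/-- "An undirected graph is CHORDAL if every cycle of length greater than three has a chord":
no chordless cycle of length `≥ 4`. [cite: VandenbergheAndersen2015, §3.1 (p. 256)] -/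
def IsChordal (G : _root_.SimpleGraph V) : Prop :=
  ∀ ⦃k : ℕ⦄ (c : Fin k → V), ¬ IsChordlessCycle G c

/-- "A vertex `v` of an undirected graph is SIMPLICIAL if its neighborhood `adj(v)` is complete."
[cite: VandenbergheAndersen2015, §3.4 (p. 263)] -/
def IsSimplicial (G : _root_.SimpleGraph V) (v : V) : Prop :=
  ∀ ⦃x y⦄, G.Adj v x → G.Adj v y → x ≠ y → G.Adj x y

/-- A PERFECT ELIMINATION ORDERING, presented as an injective labelling `f : V → ℕ` (the position
`σ⁻¹(v)` of each vertex): the ordered graph is filled / monotone transitive — whenever `u` precedes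
two distinct neighbours `v, w`, they are adjacent ((4.1); "an ordering `σ` … is called a perfect
elimination ordering if the ordered graph `G_σ` is filled").
[cite: VandenbergheAndersen2015, §4.2 (p. 276)] -/
structure IsPerfectEliminationLabelling (G : _root_.SimpleGraph V) (f : V → ℕ) : Prop where
  injective : Function.Injective f
  adj_of_lt : ∀ ⦃u v w⦄, f u < f v → f u < f w → v ≠ w → G.Adj u v → G.Adj u w → G.Adj v w

variable {G : _root_.SimpleGraph V}

/-! ### Hereditary property -/

/-- "Subgraphs `G(W)` of a chordal graph are chordal … because cycles and chords in the subgraph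
`G(W)` are also cycles and chords in `G`." [cite: VandenbergheAndersen2015, §3.1 (p. 257)] -/
theorem IsChordlessCycle.of_induce {s : Set V} {k : ℕ} {c : Fin k → s}
    (hc : IsChordlessCycle (G.induce s) c) : IsChordlessCycle G (fun i => (c i : V)) where
  four_le := hc.four_le
  injective := Subtype.val_injective.comp hc.injective
  adj_next i := by simpa [SimpleGraph.induce_adj] using hc.adj_next i
  no_chord i j h := hc.no_chord (by simpa [SimpleGraph.induce_adj] using h)

/-- Induced subgraphs of a chordal graph are chordal. [cite: VandenbergheAndersen2015, §3.1 (p. 257)] -/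
theorem IsChordal.induce (hG : IsChordal G) (s : Set V) : IsChordal (G.induce s) :=
  fun _ _ hc => hG _ hc.of_induce

/-! ### A filled ordered graph is chordal ([VA15, §4.1]) -/

/-- Index bookkeeping on a cycle of length `k ≥ 4`: a vertex, its successor, the successor of
that, and the third successor are four distinct positions. [folklore] -/
private theorem finRotate_iter_ne {k : ℕ} (hk : 4 ≤ k) (m : Fin k) :
    finRotate k m ≠ m ∧ finRotate k (finRotate k m) ≠ m ∧
      finRotate k (finRotate k (finRotate k m)) ≠ m := by
  obtain ⟨n, rfl⟩ : ∃ n, k = n + 1 := ⟨k - 1, by omega⟩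
  have hv : ∀ x : Fin (n + 1), ((finRotate (n + 1) x : Fin (n + 1)) : ℕ) =
      if (x : ℕ) = n then 0 else (x : ℕ) + 1 := fun x => by
    rw [coe_finRotate]
    simp only [Fin.ext_iff, Fin.val_last]
  have h0 := hv m
  have h1 := hv (finRotate (n + 1) m)
  have h2 := hv (finRotate (n + 1) (finRotate (n + 1) m))
  have hm := m.isLt
  refine ⟨fun h => ?_, fun h => ?_, fun h => ?_⟩
  · have := congrArg Fin.val h
    split_ifs at h0 <;> omega
  · have := congrArg Fin.val h
    split_ifs at h0 h1 <;> omega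
  · have := congrArg Fin.val h
    split_ifs at h0 h1 h2 <;> omega

/-- "An immediate consequence of monotone transitivity is that `G = (V, E, σ)` is chordal": in a
cycle of length greater than three, the vertex `v` of least index has its two cycle-neighbours in
`adj⁺(v)`, so they are adjacent — a chord.  Here the ordering is the linear order of `V` and
"filled" is `MonotoneTransitive G.Adj` ((4.1), from `ChordalPositiveSemidefinite`).
[cite: VandenbergheAndersen2015, §4.1 (p. 276)] -/
theorem isChordal_of_monotoneTransitive [LinearOrder V] (hE : MonotoneTransitive G.Adj) :
    IsChordal G := by
  intro k c hc
  have hk := hc.four_le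
  obtain ⟨m, -, hmin⟩ :=
    Finset.univ.exists_min_image c ⟨⟨0, by omega⟩, Finset.mem_univ _⟩
  set r := finRotate k with hr
  obtain ⟨h1, h2, h3⟩ := finRotate_iter_ne hk m
  have hb : r (r.symm m) = m := r.apply_symm_apply m
  have ha_adj : G.Adj (c m) (c (r m)) := hc.adj_next m
  have hb_adj : G.Adj (c m) (c (r.symm m)) := by
    have := hc.adj_next (r.symm m)
    rw [hb] at this
    exact this.symm
  have hma : c m < c (r m) :=
    lt_of_le_of_ne (hmin _ (Finset.mem_univ _)) fun h => h1 (hc.injective h).symm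
  have hmb : c m < c (r.symm m) := by
    refine lt_of_le_of_ne (hmin _ (Finset.mem_univ _)) fun h => h1 ?_
    have h' : m = r.symm m := hc.injective h
    calc r m = r (r.symm m) := by rw [← h']
      _ = m := hb
  have hab : c (r m) ≠ c (r.symm m) := fun h => by
    have h' : r m = r.symm m := hc.injective h
    exact h2 (by rw [h', hb])
  have hchord : G.Adj (c (r m)) (c (r.symm m)) := hE hma hmb hab ha_adj hb_adj
  rcases hc.no_chord hchord with h | h
  · exact h3 (by rw [← h, hb])
  · exact h1 (by rw [h, hb])

/-- The labelling form: a graph with a perfect elimination ordering is chordal ([VA15, Thm 4.1],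
the "if" part). [cite: VandenbergheAndersen2015, §4.2 Thm 4.1 (p. 276)] -/
theorem IsPerfectEliminationLabelling.isChordal {f : V → ℕ}
    (hf : IsPerfectEliminationLabelling G f) : IsChordal G := by
  letI : LinearOrder V := LinearOrder.lift' f hf.injective
  exact isChordal_of_monotoneTransitive (fun i j k hij hik hjk h1 h2 => hf.adj_of_lt hij hik hjk h1 h2)

/-! ### Dirac's simplicial vertex theorem (named fact) and [VA15, Thm 4.1] -/

/-- NAMED STATEMENT — Dirac's simplicial vertex theorem [VA15, Thm 3.3, first sentence; Dirac
1961 = VA15 ref. 74, Thm 4; Rose 1970 = ref. 193, Lemma 6]: "Every chordal graph has at least one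
simplicial vertex" (finite, non-empty; universe-polymorphic in the vertex type).  It is used as a
hypothesis in the first proof of [VA15, Thm 4.1] below, exactly as [VA15] uses it, and it is PROVED
further down (`diracSimplicialVertexTheorem_holds`, through [VA15, Thm 3.1]); the primed statements
at the end of the file are the unconditional forms.
[cite: VandenbergheAndersen2015, §3.4 Thm 3.3 (p. 264)] -/
def DiracSimplicialVertexTheorem : Prop :=
  ∀ (W : Type u) [Finite W] [Nonempty W] (H : _root_.SimpleGraph W),
    IsChordal H → ∃ v, IsSimplicial H v

/-- [VA15, Thm 4.1] ("only if", Fulkerson–Gross [VA15, ref. 88, p. 851]): a chordal graph has a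
perfect elimination ordering — by induction, putting a simplicial vertex (Dirac, Thm 3.3) first and
ordering `G(V ∖ {v})` by the induction hypothesis ("simplicial elimination").  Conditional on the
named fact `DiracSimplicialVertexTheorem`. [cite: VandenbergheAndersen2015, §4.2 Thm 4.1 (pp. 276–277)] -/
theorem IsChordal.exists_isPerfectEliminationLabelling [Finite V]
    (hD : DiracSimplicialVertexTheorem.{u}) (hG : IsChordal G) :
    ∃ f : V → ℕ, IsPerfectEliminationLabelling G f := by
  classical
  -- relativised statement on finite vertex sets, by strong induction
  suffices key : ∀ S : Finset V, ∃ f : V → ℕ, Set.InjOn f S ∧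
      ∀ u ∈ S, ∀ v ∈ S, ∀ w ∈ S, f u < f v → f u < f w → v ≠ w →
        G.Adj u v → G.Adj u w → G.Adj v w by
    cases nonempty_fintype V
    obtain ⟨f, hinj, hf⟩ := key Finset.univ
    exact ⟨f, ⟨fun a b h => hinj (Finset.mem_univ a) (Finset.mem_univ b) h,
      fun u v w h1 h2 h3 h4 h5 => hf u (Finset.mem_univ u) v (Finset.mem_univ v) w
        (Finset.mem_univ w) h1 h2 h3 h4 h5⟩⟩
  intro S
  induction S using Finset.strongInduction with
  | H S ih =>
    rcases S.eq_empty_or_nonempty with hS | hS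
    · exact ⟨fun _ => 0, by simp [hS], by simp [hS]⟩
    -- a simplicial vertex of the induced subgraph `G(S)`
    haveI : Nonempty (↥(S : Set V)) := ⟨⟨hS.choose, by simpa using hS.choose_spec⟩⟩
    obtain ⟨⟨s, hsS⟩, hs⟩ := hD (↥(S : Set V)) (G.induce (S : Set V)) (hG.induce _)
    have hsS' : s ∈ S := by simpa using hsS
    obtain ⟨f, hinj, hf⟩ := ih (S.erase s) (Finset.erase_ssubset hsS')
    refine ⟨fun x => if x = s then 0 else f x + 1, ?_, ?_⟩
    · intro a ha b hb hab
      by_cases has : a = s <;> by_cases hbs : b = s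
      · exact has.trans hbs.symm
      · simp [has, hbs] at hab
      · simp [has, hbs] at hab
      · simp only [has, hbs, if_false, add_left_inj] at hab
        exact hinj (Finset.mem_erase.2 ⟨has, ha⟩) (Finset.mem_erase.2 ⟨hbs, hb⟩) hab
    · intro u hu v hv w hw h1 h2 hvw huv huw
      have hvs : v ≠ s := by rintro rfl; simp at h1
      have hws : w ≠ s := by rintro rfl; simp at h2
      by_cases hus : u = s
      · subst hus
        have := @hs ⟨v, by simpa using hv⟩ ⟨w, by simpa using hw⟩
          (by simpa [SimpleGraph.induce_adj] using huv) (by simpa [SimpleGraph.induce_adj] using huw)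
          (fun h => hvw (congrArg Subtype.val h))
        simpa [SimpleGraph.induce_adj] using this
      · simp only [hus, hvs, hws, if_false, add_lt_add_iff_right] at h1 h2
        exact hf u (Finset.mem_erase.2 ⟨hus, hu⟩) v (Finset.mem_erase.2 ⟨hvs, hv⟩) w
          (Finset.mem_erase.2 ⟨hws, hw⟩) h1 h2 hvw huv huw

/-- [VA15, Thm 4.1] (Fulkerson–Gross): "A graph is chordal if and only if it has a perfect
elimination ordering" — conditional on Dirac's theorem for the "only if" half.
[cite: VandenbergheAndersen2015, §4.2 Thm 4.1 (p. 276)] -/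
theorem isChordal_iff_exists_isPerfectEliminationLabelling [Finite V]
    (hD : DiracSimplicialVertexTheorem.{u}) :
    IsChordal G ↔ ∃ f : V → ℕ, IsPerfectEliminationLabelling G f :=
  ⟨fun hG => hG.exists_isPerfectEliminationLabelling hD, fun ⟨_, hf⟩ => hf.isChordal⟩

/-- The same with the ordering as a `LinearOrder` structure on `V`, in the form used by the
companion files on sparse matrices (`MonotoneTransitive G.Adj` for the order of the index type):
a finite graph is chordal iff SOME linear order of its vertices is a perfect elimination ordering.
[cite: VandenbergheAndersen2015, §4.2 Thm 4.1 (p. 276)] -/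
theorem isChordal_iff_exists_linearOrder_monotoneTransitive [Finite V]
    (hD : DiracSimplicialVertexTheorem.{u}) :
    IsChordal G ↔ ∃ o : LinearOrder V, @MonotoneTransitive V o.toPartialOrder.toPreorder.toLT G.Adj := by
  constructor
  · intro hG
    obtain ⟨f, hf⟩ := hG.exists_isPerfectEliminationLabelling hD
    exact ⟨LinearOrder.lift' f hf.injective,
      fun i j k hij hik hjk h1 h2 => hf.adj_of_lt hij hik hjk h1 h2⟩
  · rintro ⟨o, ho⟩
    letI := o
    exact isChordal_of_monotoneTransitive ho

/-! ### Proof of Dirac's theorem ([VA15, Thm 3.1 and Thm 3.3])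

The argument of [VA15, §3.3–3.4], relativised to finite vertex sets `T` of the ambient type (so that
the induction on the number of vertices needs no subtypes): paths of `G(U)` are the reflexive–
transitive closure `Linked G U` of the adjacency restricted to `U`; a minimum `vw`-separator `S` is
complete (Thm 3.1: two non-adjacent `x, y ∈ S` would be joined by shortest detours through the
components of `v` and of `w` in `G(T ∖ S)`, closing up to a chordless cycle of length `≥ 4`); and
Dirac's induction (Thm 3.3, with Rose's strengthening "a non-complete chordal graph has two
non-adjacent simplicial vertices") runs on `G(C_v ∪ S)` and `G(C_w ∪ S)`. -/

section DiracProof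

open Relation


/-- Adjacency of the graph `G(U)`: `p ~ q` with both end points in the vertex set `U`. [folklore] -/
private def AdjIn (G : _root_.SimpleGraph V) (U : Finset V) (p q : V) : Prop :=
  G.Adj p q ∧ p ∈ U ∧ q ∈ U

/-- `Linked G U p q`: `p` and `q` are joined by a path of `G(U)` (reflexive–transitive closure of
`AdjIn G U`); for `p ∈ U` the vertices linked to `p` form the connected component of `p` in `G(U)`.
[folklore] -/
private def Linked (G : _root_.SimpleGraph V) (U : Finset V) : V → V → Prop :=
  ReflTransGen (AdjIn G U)

/-- [folklore] -/
private theorem Linked.rfl' {U : Finset V} {a : V} : Linked G U a a := ReflTransGen.refl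

/-- [folklore] -/
private theorem Linked.symm {U : Finset V} {a b : V} (h : Linked G U a b) : Linked G U b a := by
  induction h with
  | refl => exact ReflTransGen.refl
  | tail _ hbc ih => exact ReflTransGen.head ⟨hbc.1.symm, hbc.2.2, hbc.2.1⟩ ih

/-- [folklore] -/
private theorem Linked.trans {U : Finset V} {a b c : V} (h₁ : Linked G U a b) (h₂ : Linked G U b c) :
    Linked G U a c :=
  ReflTransGen.trans h₁ h₂

/-- [folklore] -/
private theorem Linked.tail {U : Finset V} {a b c : V} (h : Linked G U a b) (hbc : AdjIn G U b c) :
    Linked G U a c :=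
  ReflTransGen.tail h hbc

/-- A vertex linked to a vertex of `U` lies in `U`. [folklore] -/
private theorem Linked.mem {U : Finset V} {a b : V} (h : Linked G U a b) (ha : a ∈ U) : b ∈ U := by
  induction h with
  | refl => exact ha
  | tail _ hbc _ => exact hbc.2.2

/-- A linked pair is joined by an explicit finite chain of adjacent vertices, all linked to the
start. [folklore] -/
private theorem Linked.exists_chain {U : Finset V} {a b : V} (h : Linked G U a b) :
    ∃ (n : ℕ) (p : ℕ → V), p 0 = a ∧ p n = b ∧ (∀ i < n, G.Adj (p i) (p (i + 1))) ∧
      ∀ i ≤ n, Linked G U a (p i) := by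
  induction h with
  | refl =>
    exact ⟨0, fun _ => a, rfl, rfl, fun i hi => (Nat.not_lt_zero _ hi).elim, fun _ _ => Linked.rfl'⟩
  | @tail b c hab hbc ih =>
    obtain ⟨n, p, h0, hn, hstep, hlink⟩ := ih
    refine ⟨n + 1, fun i => if i ≤ n then p i else c, by simp [h0], by simp, ?_, ?_⟩
    · intro i hi
      by_cases hi' : i + 1 ≤ n
      · have h1 : i ≤ n := by omega
        simp only [h1, hi', if_true]
        exact hstep i (by omega)
      · have h1 : i = n := by omega
        subst h1
        simp only [le_refl, if_true, hi', if_false, hn]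
        exact hbc.1
    · intro i hi
      by_cases h1 : i ≤ n
      · simp only [h1, if_true]; exact hlink i h1
      · simp only [h1, if_false]; exact Linked.tail hab hbc

/-! #### Detours and their minimal representatives -/

/-- The value of the cyclic successor `finRotate k` on `Fin k`. [folklore] -/
private theorem val_finRotate {k : ℕ} (x : Fin k) :
    ((finRotate k x : Fin k) : ℕ) = if (x : ℕ) + 1 = k then 0 else (x : ℕ) + 1 := by
  obtain ⟨n, rfl⟩ : ∃ n, k = n + 1 := ⟨k - 1, (Nat.succ_pred_eq_of_pos x.pos).symm⟩
  rw [coe_finRotate]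
  simp only [Fin.ext_iff, Fin.val_last]
  split_ifs <;> omega

/-- `IsDetour G x y C n p`: `p 0 = x, p 1, …, p n = y` is a walk of `G` whose interior vertices
`p 1, …, p (n-1)` lie in `C`. [folklore] -/
private def IsDetour (G : _root_.SimpleGraph V) (x y : V) (C : Set V) (n : ℕ) (p : ℕ → V) : Prop :=
  p 0 = x ∧ p n = y ∧ (∀ i < n, G.Adj (p i) (p (i + 1))) ∧ ∀ i, 0 < i → i < n → p i ∈ C

/-- A detour of minimum length. [folklore] -/
private structure IsMinDetour (G : _root_.SimpleGraph V) (x y : V) (C : Set V) (n : ℕ) (p : ℕ → V) :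
    Prop where
  detour : IsDetour G x y C n p
  min : ∀ m < n, ∀ q, ¬ IsDetour G x y C m q

/-- [folklore] -/
private theorem IsDetour.exists_isMinDetour {x y : V} {C : Set V} {n : ℕ} {p : ℕ → V}
    (hp : IsDetour G x y C n p) : ∃ m q, IsMinDetour G x y C m q := by
  classical
  have hex : ∃ m, ∃ q, IsDetour G x y C m q := ⟨n, p, hp⟩
  exact ⟨Nat.find hex, (Nat.find_spec hex).choose, (Nat.find_spec hex).choose_spec,
    fun m hm q hq => Nat.find_min hex hm ⟨q, hq⟩⟩

/-- Splicing out the segment strictly between positions `i` and `i + d + 1` of a detour along a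
chord (or a repeated vertex) gives a detour shorter by `d`. [folklore] -/
private theorem IsDetour.splice {x y : V} {C : Set V} {n : ℕ} {p : ℕ → V}
    (hp : IsDetour G x y C n p) {i d : ℕ} (hid : i + d + 1 ≤ n)
    (hadj : G.Adj (p i) (p (i + d + 1))) :
    IsDetour G x y C (n - d) (fun t => if t ≤ i then p t else p (t + d)) := by
  obtain ⟨h0, hn, hstep, hint⟩ := hp
  refine ⟨by simp [h0], ?_, ?_, ?_⟩
  · have h : ¬ n - d ≤ i := by omega
    simp only [h, if_false]
    rw [show n - d + d = n by omega, hn]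
  · intro t ht
    by_cases h1 : t + 1 ≤ i
    · have h2 : t ≤ i := by omega
      simp only [h1, h2, if_true]
      exact hstep t (by omega)
    · by_cases h2 : t ≤ i
      · have h3 : t = i := by omega
        subst h3
        simp only [le_refl, if_true, h1, if_false]
        rw [show t + 1 + d = t + d + 1 by ring]
        exact hadj
      · simp only [h1, h2, if_false]
        rw [show t + 1 + d = (t + d) + 1 by ring]
        exact hstep _ (by omega)
  · intro t ht0 htn
    by_cases h2 : t ≤ i
    · simp only [h2, if_true]; exact hint t ht0 (by omega)
    · simp only [h2, if_false]; exact hint _ (by omega) (by omega)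

/-- A minimal detour has no chords. [folklore] -/
private theorem IsMinDetour.no_shortcut {x y : V} {C : Set V} {n : ℕ} {p : ℕ → V}
    (h : IsMinDetour G x y C n p) {i j : ℕ} (hij : i + 2 ≤ j) (hj : j ≤ n) : ¬ G.Adj (p i) (p j) := by
  intro hadj
  have hs := h.detour.splice (i := i) (d := j - i - 1) (by omega)
    (by rw [show i + (j - i - 1) + 1 = j by omega]; exact hadj)
  exact h.min (n - (j - i - 1)) (by omega) _ hs

/-- A minimal detour between distinct non-adjacent vertices has length `≥ 2`. [folklore] -/
private theorem IsMinDetour.two_le {x y : V} {C : Set V} {n : ℕ} {p : ℕ → V}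
    (h : IsMinDetour G x y C n p) (hxy : x ≠ y) (hadj : ¬ G.Adj x y) : 2 ≤ n := by
  obtain ⟨h0, hn, hstep, -⟩ := h.detour
  by_contra hlt
  push Not at hlt
  interval_cases n
  · exact hxy (h0.symm.trans hn)
  · have := hstep 0 one_pos
    rw [h0, zero_add, hn] at this
    exact hadj this

/-- A minimal detour (with `x ≠ y` and `y` outside `C`) does not repeat vertices. [folklore] -/
private theorem IsMinDetour.inj {x y : V} {C : Set V} {n : ℕ} {p : ℕ → V}
    (h : IsMinDetour G x y C n p) (hxy : x ≠ y) (hyC : y ∉ C) {i j : ℕ} (hi : i ≤ n) (hj : j ≤ n)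
    (hpij : p i = p j) : i = j := by
  obtain ⟨h0, hn, hstep, hint⟩ := h.detour
  have key : ∀ i j, i < j → j ≤ n → p i = p j → False := by
    intro i j hlt hj hpij
    rcases Nat.lt_or_ge j n with hjn | hjn
    · have hs := h.detour.splice (i := i) (d := j - i) (by omega)
        (by rw [show i + (j - i) + 1 = j + 1 by omega, hpij]; exact hstep j hjn)
      exact h.min _ (by omega) _ hs
    · have hjn' : j = n := le_antisymm hj hjn
      subst hjn'
      rcases Nat.eq_zero_or_pos i with hi0 | hi0
      · subst hi0
        exact hxy (h0.symm.trans (hpij.trans hn))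
      · have := hint i hi0 hlt
        rw [hpij, hn] at this
        exact hyC this
  by_contra hne
  rcases Nat.lt_or_gt_of_ne hne with hlt | hlt
  · exact key i j hlt hj hpij
  · exact key j i hlt hi hpij.symm

/-- Two minimal detours between the distinct non-adjacent vertices `x, y`, through vertex sets
`C₁, C₂` avoiding `x, y`, with no vertex in common and no edge between them, close up to a
chordless cycle of length `≥ 4` (the cycle in the proof of [VA15, Thm 3.1]).
[cite: VandenbergheAndersen2015, §3.3 Thm 3.1, proof (p. 262)] -/
private theorem exists_isChordlessCycle_of_isMinDetour {x y : V} {C₁ C₂ : Set V} {m l : ℕ}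
    {p q : ℕ → V} (hxy : x ≠ y) (hadj : ¬ G.Adj x y)
    (hx₂ : x ∉ C₂) (hy₁ : y ∉ C₁) (hy₂ : y ∉ C₂)
    (hsep : ∀ ⦃a b⦄, a ∈ C₁ → b ∈ C₂ → a ≠ b ∧ ¬ G.Adj a b)
    (hp : IsMinDetour G x y C₁ m p) (hq : IsMinDetour G x y C₂ l q) :
    ∃ (k : ℕ) (c : Fin k → V), IsChordlessCycle G c ∧
      ∀ i, c i = x ∨ c i = y ∨ c i ∈ C₁ ∨ c i ∈ C₂ := by
  have hm := hp.two_le hxy hadj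
  have hl := hq.two_le hxy hadj
  obtain ⟨hp0, hpm, hpstep, hpint⟩ := hp.detour
  obtain ⟨hq0, hql, hqstep, hqint⟩ := hq.detour
  -- the closed walk: `p 0 … p m = q l, q (l-1), …, q 1` (and back to `q 0 = p 0 = x`)
  set r : ℕ → V := fun t => if t ≤ m then p t else q (m + l - t) with hr
  have r_le : ∀ t, t ≤ m → r t = p t := fun t ht => by simp [hr, ht]
  have r_gt : ∀ t, m < t → r t = q (m + l - t) := fun t ht => by simp [hr, not_le.2 ht]
  -- adjacency along `r` only between cyclically consecutive positions
  have hadjr : ∀ t t', t < t' → t' < m + l → G.Adj (r t) (r t') →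
      t' = t + 1 ∨ (t = 0 ∧ t' = m + l - 1) := by
    intro t t' htt' ht' h
    by_cases ht'm : t' ≤ m
    · rw [r_le t (by omega), r_le t' ht'm] at h
      rcases Nat.lt_or_ge t' (t + 2) with h1 | h1
      · left; omega
      · exact absurd h (hp.no_shortcut h1 ht'm)
    · push Not at ht'm
      rw [r_gt t' ht'm] at h
      have hs0 : 0 < m + l - t' := by omega
      have hsl : m + l - t' < l := by omega
      by_cases htm : t ≤ m
      · rw [r_le t htm] at h
        rcases Nat.eq_zero_or_pos t with ht0 | ht0
        · -- `x ~ q s` forces `s = 1`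
          subst ht0
          rw [hp0, ← hq0] at h
          rcases Nat.lt_or_ge (m + l - t') 2 with h1 | h1
          · right; omega
          · exact absurd h (hq.no_shortcut h1 hsl.le)
        · by_cases htm' : t = m
          · -- `y = q l ~ q s` forces `s = l - 1`
            rw [htm', hpm, ← hql] at h
            rcases Nat.lt_or_ge (m + l - t' + 2) (l + 1) with h1 | h1
            · exact absurd h.symm (hq.no_shortcut (by omega) le_rfl)
            · left; omega
          · -- an interior vertex of `p` is not adjacent to an interior vertex of `q`
            exact absurd h (hsep (hpint t ht0 (by omega)) (hqint _ hs0 hsl)).2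
      · push Not at htm
        rw [r_gt t htm] at h
        -- `q s₁ ~ q s` with `s < s₁ ≤ l - 1`
        rcases Nat.lt_or_ge (m + l - t' + 2) (m + l - t + 1) with h1 | h1
        · exact absurd h.symm (hq.no_shortcut (by omega) (by omega))
        · left; omega
  -- distinct positions carry distinct vertices
  have hne_mixed : ∀ t t', t ≤ m → m < t' → t' < m + l → r t ≠ r t' := by
    intro t t' ht ht' ht'k h
    rw [r_le t ht, r_gt t' ht'] at h
    have hs0 : 0 < m + l - t' := by omega
    have hsl : m + l - t' < l := by omega
    have hq' := hqint _ hs0 hsl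
    rcases Nat.eq_zero_or_pos t with ht0 | ht0
    · subst ht0; rw [hp0] at h; exact hx₂ (h ▸ hq')
    · by_cases htm : t = m
      · rw [htm, hpm] at h; exact hy₂ (h ▸ hq')
      · exact (hsep (hpint t ht0 (by omega)) hq').1 h
  have hinj : ∀ t t', t ≤ t' → t' < m + l → r t = r t' → t = t' := by
    intro t t' htt' ht' h
    by_cases ht'm : t' ≤ m
    · rw [r_le t (by omega), r_le t' ht'm] at h
      exact hp.inj hxy hy₁ (by omega) ht'm h
    · push Not at ht'm
      by_cases htm : t ≤ m
      · exact absurd h (hne_mixed t t' htm ht'm ht')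
      · push Not at htm
        rw [r_gt t htm, r_gt t' ht'm] at h
        have := hq.inj hxy hy₂ (by omega) (by omega) h
        omega
  refine ⟨m + l, fun i => r i, ⟨by omega, ?_, ?_, ?_⟩, ?_⟩
  · -- injective
    intro i j h
    apply Fin.ext
    rcases le_total (i : ℕ) j with hij | hij
    · exact hinj _ _ hij j.isLt h
    · exact (hinj _ _ hij i.isLt h.symm).symm
  · -- consecutive vertices are adjacent
    intro i
    show G.Adj (r i) (r (finRotate (m + l) i))
    rw [val_finRotate]
    split_ifs with hlast
    · -- last position `q 1` back to `x = q 0`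
      rw [r_gt _ (by omega), r_le 0 (by omega), hp0, ← hq0,
        show m + l - (i : ℕ) = 0 + 1 by omega]
      exact (hqstep 0 (by omega)).symm
    · have hi := i.isLt
      rcases Nat.lt_or_ge (i : ℕ) m with him | him
      · rw [r_le _ him.le, r_le _ (by omega)]
        exact hpstep _ him
      · rcases him.eq_or_lt with him' | him'
        · -- `y = q l ~ q (l - 1)`
          rw [r_le _ him'.symm.le, ← him', hpm, ← hql, r_gt _ (by omega),
            show m + l - (m + 1) = l - 1 by omega]
          have := hqstep (l - 1) (by omega)
          rw [show l - 1 + 1 = l by omega] at this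
          exact this.symm
        · rw [r_gt _ him', r_gt _ (by omega)]
          have := hqstep (m + l - ((i : ℕ) + 1)) (by omega)
          rw [show m + l - ((i : ℕ) + 1) + 1 = m + l - (i : ℕ) by omega] at this
          exact this.symm
  · -- no chord
    intro i j h
    rw [Fin.ext_iff, Fin.ext_iff, val_finRotate, val_finRotate]
    rcases lt_trichotomy (i : ℕ) j with hij | hij | hij
    · have := hadjr _ _ hij j.isLt h
      split_ifs <;> omega
    · have hij' : i = j := Fin.ext hij
      subst hij'
      exact (G.irrefl h).elim
    · have := hadjr _ _ hij i.isLt h.symm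
      split_ifs <;> omega
  · -- where the vertices live
    intro i
    show r i = x ∨ r i = y ∨ r i ∈ C₁ ∨ r i ∈ C₂
    by_cases him : (i : ℕ) ≤ m
    · rw [r_le _ him]
      rcases Nat.eq_zero_or_pos (i : ℕ) with hi0 | hi0
      · exact Or.inl (by rw [hi0, hp0])
      · rcases him.eq_or_lt with him' | him'
        · exact Or.inr (Or.inl (by rw [him', hpm]))
        · exact Or.inr (Or.inr (Or.inl (hpint _ hi0 him')))
    · push Not at him
      rw [r_gt _ him]
      exact Or.inr (Or.inr (Or.inr (hqint _ (by omega) (by have := i.isLt; omega))))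

/-- A walk inside one component, extended by an edge at each end, is a detour; hence a minimal
detour through that component exists. [folklore] -/
private theorem exists_isMinDetour_of_linked {U : Finset V} {v x y a₁ a₂ : V}
    (ha₁ : Linked G U v a₁) (ha₂ : Linked G U v a₂) (hx : G.Adj a₁ x) (hy : G.Adj a₂ y) :
    ∃ m p, IsMinDetour G x y {z | Linked G U v z} m p := by
  obtain ⟨n, q, hq0, hqn, hqstep, hqlink⟩ := (ha₁.symm.trans ha₂).exists_chain
  refine IsDetour.exists_isMinDetour (n := n + 2)
    (p := fun t => if t = 0 then x else if t ≤ n + 1 then q (t - 1) else y) ⟨by simp, ?_, ?_, ?_⟩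
  · simp [show ¬ (n + 2 ≤ n + 1) by omega]
  · intro i hi
    rcases Nat.eq_zero_or_pos i with hi0 | hi0
    · subst hi0
      simpa [hq0] using hx.symm
    · have h1 : i ≠ 0 := by omega
      have h2 : i ≤ n + 1 := by omega
      have h3 : i + 1 ≠ 0 := by omega
      by_cases h4 : i + 1 ≤ n + 1
      · simp only [h1, h2, h3, h4, if_false, if_true]
        have := hqstep (i - 1) (by omega)
        rwa [show i - 1 + 1 = i + 1 - 1 by omega] at this
      · simp only [h1, h2, h3, h4, if_false, if_true]
        rw [show i - 1 = n by omega, hqn]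
        exact hy
  · intro i hi0 hin
    have h1 : i ≠ 0 := by omega
    have h2 : i ≤ n + 1 := by omega
    simp only [h1, h2, if_false, if_true, Set.mem_setOf_eq]
    exact ha₁.trans (hqlink (i - 1) (by omega))

/-! #### Minimal vertex separators of a chordal graph are complete ([VA15, Thm 3.1]) -/

/-- If `S` separates `v` from `w` in `G(T)` but `S ∖ {x}` does not, then `x` has a neighbour in the
component of `v` in `G(T ∖ S)` (the step "`v` must be adjacent to a vertex in `S` by minimality"
of [VA15, Thm 3.1, proof]). [cite: VandenbergheAndersen2015, §3.3 Thm 3.1, proof (p. 262)] -/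
private theorem exists_adj_linked_of_erase [DecidableEq V] {T S : Finset V} {v w x : V}
    (hv : v ∈ T \ S)
    (hsep : ¬ Linked G (T \ S) v w) (hlink : Linked G (T \ S.erase x) v w) :
    ∃ a, Linked G (T \ S) v a ∧ a ∈ T \ S ∧ G.Adj a x := by
  have key : ∀ z, Linked G (T \ S.erase x) v z →
      Linked G (T \ S) v z ∨ ∃ a, Linked G (T \ S) v a ∧ a ∈ T \ S ∧ G.Adj a x := by
    intro z hz
    induction hz with
    | refl => exact Or.inl Linked.rfl'
    | @tail b c _ hbc ih =>
      rcases ih with hb | hdone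
      · have hbU : b ∈ T \ S := hb.mem hv
        by_cases hc : c ∈ T \ S
        · exact Or.inl (hb.tail ⟨hbc.1, hbU, hc⟩)
        · have hcx : c = x := by
            have h1 := hbc.2.2
            rw [Finset.mem_sdiff, Finset.mem_erase] at h1
            rw [Finset.mem_sdiff] at hc
            by_contra hne
            exact hc ⟨h1.1, fun hcS => h1.2 ⟨hne, hcS⟩⟩
          exact Or.inr ⟨b, hb, hbU, hcx ▸ hbc.1⟩
      · exact Or.inr hdone
  rcases key w hlink with h | h
  · exact absurd h hsep
  · exact h

/-- Chordality relativised to a vertex set `T`: no chordless cycle of `G` inside `T`, i.e. `G(T)`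
is chordal. [folklore] -/
private def ChordalOn (G : _root_.SimpleGraph V) (T : Finset V) : Prop :=
  ∀ ⦃k : ℕ⦄ (c : Fin k → V), (∀ i, c i ∈ T) → ¬ IsChordlessCycle G c

/-- `G(T)` is complete. [folklore] -/
private def CompleteOn (G : _root_.SimpleGraph V) (T : Finset V) : Prop :=
  ∀ ⦃a⦄, a ∈ T → ∀ ⦃b⦄, b ∈ T → a ≠ b → G.Adj a b

/-- `a` is simplicial in `G(T)` (its neighbours inside `T` are pairwise adjacent). [folklore] -/
private def SimplicialIn (G : _root_.SimpleGraph V) (T : Finset V) (a : V) : Prop :=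
  ∀ ⦃x⦄, x ∈ T → ∀ ⦃y⦄, y ∈ T → G.Adj a x → G.Adj a y → x ≠ y → G.Adj x y

/-- [VA15, Thm 3.1] (Dirac), in relativised form: a `vw`-separator `S` of the chordal graph `G(T)`
none of whose one-vertex deletions `S ∖ {x}` separates (e.g. a minimum one) is complete — two
non-adjacent `x ≠ y` in `S` would close two minimal detours, through the components of `v` and of
`w` in `G(T ∖ S)`, into a chordless cycle of length at least four.
[cite: VandenbergheAndersen2015, §3.3 Thm 3.1 (pp. 261–262)] -/
private theorem adj_of_mem_minSeparator [DecidableEq V] {T S : Finset V} {v w : V} (hT : ChordalOn G T)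
    (hS : S ⊆ T) (hv : v ∈ T \ S) (hw : w ∈ T \ S) (hsep : ¬ Linked G (T \ S) v w)
    (hmin : ∀ x ∈ S, Linked G (T \ S.erase x) v w) {x y : V} (hx : x ∈ S) (hy : y ∈ S)
    (hxy : x ≠ y) : G.Adj x y := by
  by_contra hadj
  have hsep' : ¬ Linked G (T \ S) w v := fun h => hsep h.symm
  obtain ⟨a₁, ha₁v, -, ha₁x⟩ := exists_adj_linked_of_erase hv hsep (hmin x hx)
  obtain ⟨a₂, ha₂v, -, ha₂y⟩ := exists_adj_linked_of_erase hv hsep (hmin y hy)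
  obtain ⟨b₁, hb₁w, -, hb₁x⟩ := exists_adj_linked_of_erase hw hsep' (hmin x hx).symm
  obtain ⟨b₂, hb₂w, -, hb₂y⟩ := exists_adj_linked_of_erase hw hsep' (hmin y hy).symm
  obtain ⟨m, p, hp⟩ := exists_isMinDetour_of_linked ha₁v ha₂v ha₁x ha₂y
  obtain ⟨l, q, hq⟩ := exists_isMinDetour_of_linked hb₁w hb₂w hb₁x hb₂y
  have hxU : x ∉ T \ S := fun h => (Finset.mem_sdiff.1 h).2 hx
  have hyU : y ∉ T \ S := fun h => (Finset.mem_sdiff.1 h).2 hy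
  have hsepC : ∀ ⦃a b⦄, a ∈ {z | Linked G (T \ S) v z} → b ∈ {z | Linked G (T \ S) w z} →
      a ≠ b ∧ ¬ G.Adj a b := by
    intro a b ha hb
    simp only [Set.mem_setOf_eq] at ha hb
    refine ⟨fun hab => hsep (ha.trans (hab ▸ hb.symm)), fun hab => hsep ?_⟩
    exact (ha.tail ⟨hab, ha.mem hv, hb.mem hw⟩).trans hb.symm
  obtain ⟨k, c, hc, hcmem⟩ := exists_isChordlessCycle_of_isMinDetour hxy hadj
    (fun h => hxU (Linked.mem h hw)) (fun h => hyU (Linked.mem h hv))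
    (fun h => hyU (Linked.mem h hw)) hsepC hp hq
  refine hT c (fun i => ?_) hc
  rcases hcmem i with h | h | h | h
  · exact h ▸ hS hx
  · exact h ▸ hS hy
  · exact (Finset.mem_sdiff.1 (Linked.mem h hv)).1
  · exact (Finset.mem_sdiff.1 (Linked.mem h hw)).1

/-! #### Dirac's induction ([VA15, Thm 3.3]) -/

/-- The component step of [VA15, Thm 3.3, proof]: with `S` a complete `vw`-separator of the chordal
`G(T)` and the theorem known for the proper subset `C_v ∪ S` (`C_v` the component of `v` in
`G(T ∖ S)`), the component `C_v` contains a vertex that is simplicial in `G(T)` — a vertex of `C_v`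
simplicial in `G(C_v ∪ S)` is simplicial in `G(T)` since all its `T`-neighbours lie in `C_v ∪ S`.
[cite: VandenbergheAndersen2015, §3.4 Thm 3.3, proof (pp. 264–265)] -/
private theorem exists_simplicialIn_of_separator [DecidableEq V] {T S : Finset V} {v w : V}
    (ih : ∀ A ⊂ T, ChordalOn G A → A.Nonempty → CompleteOn G A ∨
      ∃ a ∈ A, ∃ b ∈ A, a ≠ b ∧ ¬ G.Adj a b ∧ SimplicialIn G A a ∧ SimplicialIn G A b)
    (hT : ChordalOn G T) (hv : v ∈ T \ S) (hw : w ∈ T \ S)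
    (hsep : ¬ Linked G (T \ S) v w) (hSc : CompleteOn G S) :
    ∃ z ∈ T \ S, Linked G (T \ S) v z ∧ SimplicialIn G T z := by
  classical
  set U := T \ S with hU
  set A : Finset V := T.filter (fun z => z ∈ S ∨ Linked G U v z) with hA
  have hwT := (Finset.mem_sdiff.1 hw).1
  have hwS := (Finset.mem_sdiff.1 hw).2
  have hvT := (Finset.mem_sdiff.1 hv).1
  have hAT : A ⊂ T := by
    refine Finset.filter_ssubset.2 ⟨w, hwT, ?_⟩
    push Not
    exact ⟨hwS, hsep⟩
  have hAc : ChordalOn G A := fun k c hc => hT c (fun i => (Finset.mem_filter.1 (hc i)).1)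
  have hvA : v ∈ A := Finset.mem_filter.2 ⟨hvT, Or.inr Linked.rfl'⟩
  -- a vertex of `C_v` that is simplicial in `G(A)` is simplicial in `G(T)`
  have hC : ∀ z, Linked G U v z → SimplicialIn G A z → SimplicialIn G T z := by
    intro z hz hzA x hx y hy hzx hzy hxy
    have memA : ∀ u, u ∈ T → G.Adj z u → u ∈ A := by
      intro u hu hzu
      by_cases huS : u ∈ S
      · exact Finset.mem_filter.2 ⟨hu, Or.inl huS⟩
      · exact Finset.mem_filter.2
          ⟨hu, Or.inr (hz.tail ⟨hzu, hz.mem hv, Finset.mem_sdiff.2 ⟨hu, huS⟩⟩)⟩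
    exact hzA (memA x hx hzx) (memA y hy hzy) hzx hzy hxy
  rcases ih A hAT hAc ⟨v, hvA⟩ with hcomp | ⟨a, ha, b, hb, hab, hnadj, hsa, hsb⟩
  · exact ⟨v, hv, Linked.rfl', hC v Linked.rfl' fun x hx y hy _ _ hxy => hcomp hx hy hxy⟩
  · have key : ∀ {a b : V}, a ∈ A → b ∈ A → a ≠ b → ¬ G.Adj a b → SimplicialIn G A a →
        a ∉ S → ∃ z ∈ T \ S, Linked G (T \ S) v z ∧ SimplicialIn G T z := by
      intro a b ha _ _ _ hsa haS
      have ha' := Finset.mem_filter.1 ha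
      have hlink : Linked G U v a := ha'.2.resolve_left haS
      exact ⟨a, Finset.mem_sdiff.2 ⟨ha'.1, haS⟩, hlink, hC a hlink hsa⟩
    by_cases haS : a ∈ S
    · have hbS : b ∉ S := fun hbS => hnadj (hSc haS hbS hab)
      exact key hb ha hab.symm (fun h => hnadj h.symm) hsb hbS
    · exact key ha hb hab hnadj hsa haS

/-- [VA15, Thm 3.3] (Dirac 1961; Rose 1970), relativised to a finite vertex set `T`: if `G(T)` is
chordal and non-empty then either `G(T)` is complete (and all its vertices are simplicial) or it
has two non-adjacent vertices that are simplicial in `G(T)`.  By strong induction on `T`: for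
non-adjacent `v, w` take a minimum `vw`-separator `S` (complete by Thm 3.1) and apply the
induction hypothesis to `C_v ∪ S` and `C_w ∪ S`.
[cite: VandenbergheAndersen2015, §3.4 Thm 3.3 (pp. 264–265)] -/
private theorem completeOn_or_exists_simplicialIn (T : Finset V) (hT : ChordalOn G T)
    (hne : T.Nonempty) : CompleteOn G T ∨
      ∃ a ∈ T, ∃ b ∈ T, a ≠ b ∧ ¬ G.Adj a b ∧ SimplicialIn G T a ∧ SimplicialIn G T b := by
  classical
  induction T using Finset.strongInduction with
  | H T ih =>
  by_cases hcomp : CompleteOn G T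
  · exact Or.inl hcomp
  right
  obtain ⟨v, hv, w, hw, hvw, hnadj⟩ : ∃ v ∈ T, ∃ w ∈ T, v ≠ w ∧ ¬ G.Adj v w := by
    by_contra hcon
    push Not at hcon
    exact hcomp fun a ha b hb hab => hcon a ha b hb hab
  -- `vw`-separators inside `T`, and one of minimum cardinality
  set P : Finset V → Prop := fun S => v ∉ S ∧ w ∉ S ∧ ¬ Linked G (T \ S) v w with hP
  have hP0 : P (T \ {v, w}) := by
    refine ⟨by simp, by simp, fun h => ?_⟩
    rcases h.cases_head with h | ⟨c, hc, -⟩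
    · exact hvw h
    · have hcvw : c ∈ ({v, w} : Finset V) := by
        have h2 := hc.2.2
        rw [Finset.mem_sdiff, Finset.mem_sdiff] at h2
        by_contra hn
        exact h2.2 ⟨h2.1, hn⟩
      simp only [Finset.mem_insert, Finset.mem_singleton] at hcvw
      rcases hcvw with rfl | rfl
      · exact G.irrefl hc.1
      · exact hnadj hc.1
  obtain ⟨S, hSF, hSmin⟩ := (T.powerset.filter P).exists_min_image Finset.card
    ⟨T \ {v, w}, Finset.mem_filter.2 ⟨Finset.mem_powerset.2 Finset.sdiff_subset, hP0⟩⟩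
  obtain ⟨hST, hvS, hwS, hsep⟩ :
      S ⊆ T ∧ v ∉ S ∧ w ∉ S ∧ ¬ Linked G (T \ S) v w := by
    have h := Finset.mem_filter.1 hSF
    exact ⟨Finset.mem_powerset.1 h.1, h.2⟩
  have hmin : ∀ x ∈ S, Linked G (T \ S.erase x) v w := by
    intro x hx
    by_contra hcon
    have hmem : S.erase x ∈ T.powerset.filter P :=
      Finset.mem_filter.2 ⟨Finset.mem_powerset.2 ((Finset.erase_subset x S).trans hST),
        fun h => hvS (Finset.mem_of_mem_erase h), fun h => hwS (Finset.mem_of_mem_erase h), hcon⟩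
    have h1 := hSmin _ hmem
    have h2 := Finset.card_erase_lt_of_mem hx
    omega
  have hv' : v ∈ T \ S := Finset.mem_sdiff.2 ⟨hv, hvS⟩
  have hw' : w ∈ T \ S := Finset.mem_sdiff.2 ⟨hw, hwS⟩
  have hSc : CompleteOn G S := fun x hx y hy hxy =>
    adj_of_mem_minSeparator hT hST hv' hw' hsep hmin hx hy hxy
  obtain ⟨a, haU, hva, hsa⟩ := exists_simplicialIn_of_separator ih hT hv' hw' hsep hSc
  obtain ⟨b, hbU, hwb, hsb⟩ :=
    exists_simplicialIn_of_separator ih hT hw' hv' (fun h => hsep h.symm) hSc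
  refine ⟨a, (Finset.mem_sdiff.1 haU).1, b, (Finset.mem_sdiff.1 hbU).1, ?_, ?_, hsa, hsb⟩
  · rintro rfl
    exact hsep (hva.trans hwb.symm)
  · intro hab
    exact hsep ((hva.tail ⟨hab, haU, hbU⟩).trans hwb.symm)

end DiracProof

/-! ### Dirac's theorem and the unconditional form of [VA15, Thm 4.1] -/

/-- [VA15, Thm 3.3] (Dirac 1961, Rose 1970), both sentences: a finite non-empty chordal graph is
either complete or has two non-adjacent simplicial vertices.
[cite: VandenbergheAndersen2015, §3.4 Thm 3.3 (p. 264)] -/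
theorem IsChordal.complete_or_exists_two_isSimplicial [Finite V] [Nonempty V]
    (hG : IsChordal G) :
    (∀ ⦃a b : V⦄, a ≠ b → G.Adj a b) ∨
      ∃ a b, a ≠ b ∧ ¬ G.Adj a b ∧ IsSimplicial G a ∧ IsSimplicial G b := by
  classical
  cases nonempty_fintype V
  rcases completeOn_or_exists_simplicialIn (G := G) Finset.univ
      (fun k c _ hc => hG c hc) Finset.univ_nonempty with h | ⟨a, -, b, -, hab, hnadj, hsa, hsb⟩
  · exact Or.inl fun a b hab => h (Finset.mem_univ a) (Finset.mem_univ b) hab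
  · exact Or.inr ⟨a, b, hab, hnadj,
      fun x y h1 h2 h3 => hsa (Finset.mem_univ x) (Finset.mem_univ y) h1 h2 h3,
      fun x y h1 h2 h3 => hsb (Finset.mem_univ x) (Finset.mem_univ y) h1 h2 h3⟩

/-- [VA15, Thm 3.3], first sentence: "Every chordal graph has at least one simplicial vertex"
(finite, non-empty). [cite: VandenbergheAndersen2015, §3.4 Thm 3.3 (p. 264)] -/
theorem IsChordal.exists_isSimplicial [Finite V] [Nonempty V] (hG : IsChordal G) :
    ∃ v, IsSimplicial G v := by
  rcases hG.complete_or_exists_two_isSimplicial with h | ⟨a, -, -, -, ha, -⟩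
  · exact ⟨Classical.arbitrary V, fun x y _ _ hxy => h hxy⟩
  · exact ⟨a, ha⟩

/-- The named fact `DiracSimplicialVertexTheorem` HOLDS (discharged by the proof above).
[cite: VandenbergheAndersen2015, §3.4 Thm 3.3 (p. 264)] -/
theorem diracSimplicialVertexTheorem_holds : DiracSimplicialVertexTheorem.{u} :=
  fun _ _ _ _ hH => hH.exists_isSimplicial

/-- [VA15, Thm 4.1] "only if", unconditionally: a finite chordal graph has a perfect elimination
ordering. [cite: VandenbergheAndersen2015, §4.2 Thm 4.1 (pp. 276–277)] -/
theorem IsChordal.exists_isPerfectEliminationLabelling' [Finite V] (hG : IsChordal G) :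
    ∃ f : V → ℕ, IsPerfectEliminationLabelling G f :=
  hG.exists_isPerfectEliminationLabelling diracSimplicialVertexTheorem_holds

/-- [VA15, Thm 4.1] (Fulkerson–Gross 1965), unconditionally: "A graph is chordal if and only if it
has a perfect elimination ordering." [cite: VandenbergheAndersen2015, §4.2 Thm 4.1 (p. 276)] -/
theorem isChordal_iff_exists_isPerfectEliminationLabelling' [Finite V] :
    IsChordal G ↔ ∃ f : V → ℕ, IsPerfectEliminationLabelling G f :=
  isChordal_iff_exists_isPerfectEliminationLabelling diracSimplicialVertexTheorem_holds

/-- [VA15, Thm 4.1] with the ordering as a `LinearOrder` structure, unconditionally: a finite graph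
is chordal iff some linear order of its vertices makes `G.Adj` monotone transitive — the hypothesis
of the chordal-sparsity matrix files. [cite: VandenbergheAndersen2015, §4.2 Thm 4.1 (p. 276)] -/
theorem isChordal_iff_exists_linearOrder_monotoneTransitive' [Finite V] :
    IsChordal G ↔
      ∃ o : LinearOrder V, @MonotoneTransitive V o.toPartialOrder.toPreorder.toLT G.Adj :=
  isChordal_iff_exists_linearOrder_monotoneTransitive diracSimplicialVertexTheorem_holds

end Literature.Combinatorics.SimpleGraph
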